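import Mathlib

set_option linter.dupNamespace false

/-!
# Motion confinement — kernel anchor for LieExponent §3.24 (Theorems 11 and 12)

Solo-blind seat `solo-MatrixMultiplication-blind`, session s16.

The pen-and-paper results anchored here (HOME `paper/LieExponent.md` §3.24):

* **Lemma 3.24 (motion confinement).** For a TPP triple of submanifolds of a real Lie
  group with generic one-dimensional configuration annihilator `λ`, the slices of the
  three level sets of the moving annihilator along the Cauchy-characteristic group `A_λ`
  are all tangent to the common subspace `𝔞_λ ∩ 𝔇^⊥`, where `𝔇` (dimension `R`, the
  total motion) is the span of the first derivatives of the annihilator and `R'` is the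
  rank of `𝔇` restricted to `𝔞_λ`.
* **Theorem 12 (Cartan-visible motion is free).** If `λ` is regular of semisimple type
  (`A_λ` abelian of dimension `ind 𝔤 − 1`), the slices pack injectively, so
  `Σ ≤ (3d − ind 𝔤)/2 − 1 + (R − R')`.
* **Theorem 11 (GL₄(ℝ)).** `Σ = 22` forces the format `(8,7,7)`; Theorem 12 with
  `d = 16, ind = 4, R = 1` forces `R' = 0` (coadjoint pencil); over Borel-type pairs the
  wall cases die by the pair bound inside a subgroup of dimension `a − 1`, and pairs of
  codimension `≥ 3` never exceed `21` by the pair bound alone.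
* **Corollary 12.2 (GL₇(ℝ), format (23,24,24)).** `R = 2` forces `R' = 0`.

What is kernel-checked below is the linear-algebra packing step (independent subspaces of
a subspace of dimension `a − R'` have total dimension at most `a − R'`) and all the
arithmetic; the differential-geometric inputs (Maurer–Cartan identity, level sets,
characteristic slicing) are pen-proofs in the paper.
-/

namespace Summit.MatrixMultiplication.MatrixMultiplication.Theorems

open Module

/-- **Packing step of Theorem 12.** Three subspaces of `W` which are independent
(`T₁ ⊓ T₂ = ⊥` and `(T₁ ⊔ T₂) ⊓ T₃ = ⊥`, i.e. the sum map `T₁ × T₂ × T₃ → V` is injective)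
have total dimension at most `dim W`.  In the paper `W = 𝔞_λ ∩ 𝔇^⊥` has dimension
`a − R'` and the `Tᵢ` are the tangent spaces of the three slices at a generic
configuration (independent because the product map of an abelian TPP triple is
injective). -/
theorem soloLie_confined_packing {K V : Type*} [DivisionRing K] [AddCommGroup V]
    [Module K V] [FiniteDimensional K V] (T₁ T₂ T₃ W : Submodule K V)
    (h₁ : T₁ ≤ W) (h₂ : T₂ ≤ W) (h₃ : T₃ ≤ W)
    (h12 : T₁ ⊓ T₂ = ⊥) (h123 : (T₁ ⊔ T₂) ⊓ T₃ = ⊥) :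
    finrank K T₁ + finrank K T₂ + finrank K T₃ ≤ finrank K W := by
  have e1 := Submodule.finrank_sup_add_finrank_inf_eq T₁ T₂
  have e2 := Submodule.finrank_sup_add_finrank_inf_eq (T₁ ⊔ T₂) T₃
  rw [h12, finrank_bot] at e1
  rw [h123, finrank_bot] at e2
  have hle : (T₁ ⊔ T₂) ⊔ T₃ ≤ W := sup_le (sup_le h₁ h₂) h₃
  have hmono := Submodule.finrank_mono hle
  omega

/-- **Theorem 12, arithmetic (CV).** Slice lower bound `S ≥ Σ − R − 3ρ/2`
(level sets lose `R`, each slice loses at most `ρ/2` by isotropy), packing `S ≤ a − R'`,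
`ρ = d − 1 − a` and `a = ι − 1` (regular semisimple annihilator) give
`Σ ≤ (3d − ι)/2 − 1 + (R − R')`. -/
theorem soloLie_cartan_visible_free (d ι a ρ sig S R R' : ℝ)
    (hS : sig - R - 3 * ρ / 2 ≤ S) (hP : S ≤ a - R') (hρ : ρ = d - 1 - a)
    (ha : a = ι - 1) :
    sig ≤ (3 * d - ι) / 2 - 1 + (R - R') := by
  linarith

/-- **Theorem 12, deficit form.** With `δ := 3d/2 − Σ` and `R_inv := R − R'`:
`δ ≥ ι/2 + 1 − R_inv`. -/
theorem soloLie_cartan_visible_free_deficit (d ι sig R R' δ : ℝ)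
    (hCV : sig ≤ (3 * d - ι) / 2 - 1 + (R - R')) (hδ : δ = 3 * d / 2 - sig) :
    ι / 2 + 1 - (R - R') ≤ δ := by
  linarith

/-- **Remark 12.1(1).** If all motion is Cartan-visible (`R' = R`) the bound is
Theorem 1's value: in `GL_n(ℝ)` (`d = n², ι = n`) it reads `Σ ≤ 3N + n − 1`
with `N = n(n−1)/2`. -/
theorem soloLie_visible_motion_capped (n sig R : ℝ)
    (hCV : sig ≤ (3 * n ^ 2 - n) / 2 - 1 + (R - R)) :
    sig ≤ 3 * (n * (n - 1) / 2) + n - 1 := by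
  nlinarith

/-- **Remark 12.1(2), consistency with Theorem 10.** In the worst case `R' = 0`,
`R ≤ 2δ − 3` the bound is exactly `(E1′)`: `δ ≥ ι/6 + 4/3`. -/
theorem soloLie_cv_recovers_E1 (ι R δ : ℝ) (h : ι / 2 + 1 - (R - 0) ≤ δ)
    (hR : R ≤ 2 * δ - 3) : ι / 6 + 4 / 3 ≤ δ := by
  linarith

/-- **Remark 12.1(4), dimension count for invisible motion.** With
`dim (V_j + V_k) = d − m`, `dim 𝔞_λ = ι − 1`, `dim (𝔞_λ ∩ (V_j+V_k)) = t`, the annihilator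
of `V_j + V_k + 𝔞_λ` has dimension `m − ι + 1 + t`; modulo `λ` this leaves at most
`m − ι + t` invisible motion directions for member `i`. -/
theorem soloLie_invisible_motion_room (d m ι t : ℤ) :
    d - ((d - m) + (ι - 1) - t) - 1 = m - ι + t := by
  ring

/-- **Theorem 11, format uniqueness.** In dimension `16`, total dimension `22` with the
pair bounds `dᵢ + dⱼ ≤ 15` (Lemma 2.1) forces the format `(8,7,7)` up to order. -/
theorem soloLie_gl4_format_877 (d₁ d₂ d₃ : ℕ) (hsum : d₁ + d₂ + d₃ = 22)
    (h12 : d₁ + d₂ ≤ 15) (h13 : d₁ + d₃ ≤ 15) (h23 : d₂ + d₃ ≤ 15) :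
    (d₁ = 8 ∧ d₂ = 7 ∧ d₃ = 7) ∨ (d₁ = 7 ∧ d₂ = 8 ∧ d₃ = 7) ∨
      (d₁ = 7 ∧ d₂ = 7 ∧ d₃ = 8) := by
  omega

/-- **Theorem 11, no larger total.** The pair bounds exclude `Σ ≥ 23` in `GL₄(ℝ)`. -/
theorem soloLie_gl4_sigma_le_22 (d₁ d₂ d₃ : ℕ)
    (h12 : d₁ + d₂ ≤ 15) (h13 : d₁ + d₃ ≤ 15) (h23 : d₂ + d₃ ≤ 15) :
    d₁ + d₂ + d₃ ≤ 22 := by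
  omega

/-- **Theorem 11(b).** `d = 16`, `ι = 4`, `Σ = 22`, `R = 1`: the bound (CV) forces
`R' = 0` — the pencil is coadjoint (tangent to the adjoint orbit cone). -/
theorem soloLie_gl4_coadjoint_forced (R' : ℕ)
    (hCV : (22 : ℝ) ≤ (3 * 16 - 4) / 2 - 1 + (1 - (R' : ℝ))) : R' = 0 := by
  have h : (R' : ℝ) ≤ 0 := by linarith
  exact_mod_cast Nat.le_zero.mp (by exact_mod_cast h)

/-- **Theorem 11(a), Case 0 directly.** Regular pencil over a Borel-type pair: three
slice curves (`σᵢ ≥ 7 − 6 = 1`) would have to pack injectively into the torus `T″` of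
dimension `a − R' = 3 − 1 = 2`. -/
theorem soloLie_gl4_case0 (σ₁ σ₂ σ₃ : ℕ) (h₁ : 1 ≤ σ₁) (h₂ : 1 ≤ σ₂) (h₃ : 1 ≤ σ₃)
    (hpack : σ₁ + σ₂ + σ₃ ≤ 3 - 1) : False := by
  omega

/-- **Theorem 11(a), wall cases 1–3.** At a singular diagonal `c` with
`a = dim 𝔷(c) − 1 ∈ {5, 7, 9}` the slices of two members have dimension
`σ ≥ 7 − ρ/2`, `ρ = 15 − a`, i.e. `2σ ≥ a − 1`, and they sit in the subgroup
`A″ = exp(𝔷(c) ∩ U)` of dimension `a − 1`; the pair bound of Lemma 2.1 inside `A″`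
(`σ + σ ≤ dim A″ − 1 = a − 2`) fails. -/
theorem soloLie_gl4_wall_cases (a σ : ℕ) (ha : a = 5 ∨ a = 7 ∨ a = 9)
    (hσ : a - 1 ≤ 2 * σ) (hpair : σ + σ ≤ (a - 1) - 1) : False := by
  omega

/-- **Theorem 11(a), codimension ≥ 3.** Over a Borel-type pair with
`d₂ + d₃ = 16 − c`, `c ≥ 3`, the pair bounds alone give `Σ ≤ 21 = F(GL₄(ℝ))`. -/
theorem soloLie_gl4_codim_ge_three (c d₁ d₂ d₃ : ℕ) (hc : 3 ≤ c) (hc' : c ≤ 16)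
    (hpair : d₂ + d₃ = 16 - c) (h12 : d₁ + d₂ ≤ 15) (h13 : d₁ + d₃ ≤ 15) :
    d₁ + d₂ + d₃ ≤ 21 := by
  omega

/-- **Corollary 12.2 (GL₇(ℝ), format (23,24,24)).** `d = 49`, `ι = 7`, `Σ = 71`,
`R = 2`: the bound (CV) forces `R' = 0` — totally orbit-tangential motion. -/
theorem soloLie_gl7_orbit_tangent_forced (R' : ℕ)
    (hCV : (71 : ℝ) ≤ (3 * 49 - 7) / 2 - 1 + (2 - (R' : ℝ))) : R' = 0 := by
  have h : (R' : ℝ) ≤ 0 := by linarith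
  exact_mod_cast Nat.le_zero.mp (by exact_mod_cast h)

/-- **Corollary 12.2, slice count.** Level sets of dimension `23`, isotropy loss
`≤ ρ/2 = 21`: slices `σᵢ ≥ 2`; three of them inside `𝔞″` of dimension `6 − R'`
force `R' = 0`. -/
theorem soloLie_gl7_slice_cube (σ₁ σ₂ σ₃ R' : ℕ) (h₁ : 23 - 21 ≤ σ₁) (h₂ : 23 - 21 ≤ σ₂)
    (h₃ : 23 - 21 ≤ σ₃) (hpack : σ₁ + σ₂ + σ₃ ≤ 6 - R') : R' = 0 := by
  omega

end Summit.MatrixMultiplication.MatrixMultiplication.Theorems
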